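import Summits.CriticalPhenomena.PercolationContinuityZ3.Theorems.Transplant.SkelSeedKit
import HarnessLib

/-!
# L5.5a′ (generic design-(D) re-typing) — the abstract seed kit with FACE VERTICES ALLOWED INSIDE THE REGION: `KitOK'` and `shyp_kit'`
# (the form the edge-contact remedy needs: a far contact has region = face = `{y}`, its face vertex is the inner neighbour itself)

builds on p205010 (kernel theorem, internal audit signed; external expert review pending) — nothing in this file uses p205010.
Lane `prim-bschramm`, seat `prim-bschramm-p1` (gen 7); helper file (`--supports stmt-CriticalPhenomena-4575 --as helper`); companion of
`SkelSeedKit` (p232099).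

`SkelSeedKit.KitOK.U_adj` asks every face vertex to have a `G`-neighbour in the seed region.  For the product's edge-contact remedy
(`BoxProdZ2Collar`: a contact near the edge of the window ball gets face `{y}` — its inner neighbour — which the caller puts into the rim
target) the face vertex IS the region `{y}`, and `y` need not have a neighbour inside `B⟨j⟩ ∩ B_G(w₀, R)` at all.  This file weakens the
face condition to "`u ∈ S x` or `u` has a neighbour in `S x`" (`KitOK'.U_adj`) and re-proves the Step-III axioms (`shyp_kit'`: an open
seed joins `x` to a face vertex inside the region through the contact edge and the open region alone); everything else is the landed
kit verbatim (`kitSData`, the seeds, the selection).  `KitOK.kitOK'` records that the landed hypotheses imply the weakened ones.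
* `KitOK'`, `KitOK.kitOK'`, **`shyp_kit'`** (the ball/disjointness steps of `SkelSeedKit` §4 inlined).

[cite: KozmaNitzan2024, §4 Lemma 10, p. 19 (Step III, seeds), p. 21 (U(P)) — the ℤ^d model] [cite: GrimmettPercolation1999, §7.2]
-/

noncomputable section

open scoped Classical

namespace Summit.CriticalPhenomena.PercolationContinuityZ3.Theorems

namespace Transplant

namespace Skel

open Literature.Probability.Percolation Literature.Probability.LatticeModels SimpleGraph KNLevels
open Literature.Barriers.CriticalPhenomena (graphBall graphBall_finite mem_graphBall_self graphBall_mono)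
open BoxProdZ2 (ballFin mem_ballFin card_ballFin_le)

variable {V : Type} {G : SimpleGraph V} [G.LocallyFinite] (Φ : PlanarSkeletonConc G)

/-- **The hypotheses on a seed geometry at the window level `j`, face vertices allowed inside the region**: as `KitOK`, except that a
face vertex either lies in the region or has a `G`-neighbour in it. [cite: KozmaNitzan2024, §4 p. 19 (Step III)] -/
structure KitOK' (w₀ : V) (R : ℕ) (lo hi : Site 2) (j rs cS cU : ℕ) (κ : KitGeom V) : Prop where
  adj : ∀ x ∈ outerBoundary (winGraph G w₀ R) (winLevel Φ w₀ R lo hi j), G.Adj x (κ.y x)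
  y_mem : ∀ x ∈ outerBoundary (winGraph G w₀ R) (winLevel Φ w₀ R lo hi j), κ.y x ∈ κ.S x
  S_sub : ∀ x ∈ outerBoundary (winGraph G w₀ R) (winLevel Φ w₀ R lo hi j), κ.S x ⊆ winLevel Φ w₀ R lo hi j
  U_sub : ∀ x ∈ outerBoundary (winGraph G w₀ R) (winLevel Φ w₀ R lo hi j), κ.U x ⊆ winLevel Φ w₀ R lo hi j
  S_ball : ∀ x ∈ outerBoundary (winGraph G w₀ R) (winLevel Φ w₀ R lo hi j), ∀ v ∈ κ.S x, v ∈ graphBall G x rs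
  U_ball : ∀ x ∈ outerBoundary (winGraph G w₀ R) (winLevel Φ w₀ R lo hi j), ∀ u ∈ κ.U x, u ∈ graphBall G x rs
  S_path : ∀ x ∈ outerBoundary (winGraph G w₀ R) (winLevel Φ w₀ R lo hi j), ∀ v ∈ κ.S x, PathIn G (↑(κ.S x) : Set V) (κ.y x) v
  U_adj : ∀ x ∈ outerBoundary (winGraph G w₀ R) (winLevel Φ w₀ R lo hi j), ∀ u ∈ κ.U x, u ∈ κ.S x ∨ ∃ v ∈ κ.S x, G.Adj v u
  S_card : ∀ x ∈ outerBoundary (winGraph G w₀ R) (winLevel Φ w₀ R lo hi j), (κ.S x).card ≤ cS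
  U_card : ∀ x ∈ outerBoundary (winGraph G w₀ R) (winLevel Φ w₀ R lo hi j), (κ.U x).card ≤ cU

variable {Φ}
variable {w₀ : V} {R : ℕ} {lo hi : Site 2} {j rs cS cU : ℕ} {κ : KitGeom V}

/-- The landed hypotheses imply the weakened ones. [folklore] -/
theorem KitOK.kitOK' (h : KitOK Φ w₀ R lo hi j rs cS cU κ) : KitOK' Φ w₀ R lo hi j rs cS cU κ :=
  ⟨h.adj, h.y_mem, h.S_sub, h.U_sub, h.S_ball, h.U_ball, h.S_path, fun x hx u hu => Or.inr (h.U_adj x hx u hu), h.S_card, h.U_card⟩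

section OK

variable (hκ : KitOK' Φ w₀ R lo hi j rs cS cU κ)
include hκ

/-- **The Step-III axioms for the abstract seed kit, face vertices allowed inside the region**: as `shyp_kit`; a face vertex inside
the region is reached from the contact through the contact edge and the open region. [cite: KozmaNitzan2024, §4 p. 19 (Step III)] -/
theorem shyp_kit' (o : V) (Sfin : Finset V) (k : ℕ) :
    SHyp (winLData Φ w₀ R lo hi o Sfin) j (kitSData Φ w₀ R lo hi j κ rs cS cU k) where
  Kont_sub ω := by
    rw [kitSData_K]
    exact (winLData Φ w₀ R lo hi o Sfin).Kont_subset j ω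
  edge x hx e he := by
    rw [kitSData_K] at hx
    rw [kitSData_seed] at he
    have hball : ∀ z ∈ e, z ∈ graphBall G w₀ R := by
      intro z hz
      rcases (κ.exists_mem_of_mem_seed he).2 z hz with rfl | rfl | h | h
      · exact mem_graphBall_of_mem_K (Φ := Φ) hx
      · exact winLevel_subset_graphBall Φ w₀ R lo hi j (hκ.S_sub _ hx (hκ.y_mem _ hx))
      · exact winLevel_subset_graphBall Φ w₀ R lo hi j (hκ.S_sub _ hx h)
      · exact winLevel_subset_graphBall Φ w₀ R lo hi j (hκ.U_sub _ hx h)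
    have hG : e ∈ G.edgeSet := by
      rcases κ.mem_seed_cases he with rfl | h | ⟨v, -, u, -, hvu, rfl⟩
      · exact (SimpleGraph.mem_edgeSet (G := G)).2 (hκ.adj _ hx)
      · exact ((mem_edgesIn_iff).1 h).1
      · exact (SimpleGraph.mem_edgeSet (G := G)).2 hvu
    induction e using Sym2.ind with
    | h a b =>
      rw [SimpleGraph.mem_edgeSet] at hG ⊢
      exact (winGraph_adj G).2 ⟨hG, hball a (Sym2.mem_mk_left a b), hball b (Sym2.mem_mk_right a b)⟩
  within x hx e he z hz := by
    rw [kitSData_K] at hx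
    rw [kitSData_seed] at he
    rw [winLData_X]
    have hmono := winLevel_monotone Φ w₀ R lo hi (Nat.le_succ j)
    rcases (κ.exists_mem_of_mem_seed he).2 z hz with rfl | rfl | h | h
    · exact winLevel_nest Φ w₀ R lo hi j hx
    · exact hmono (hκ.S_sub _ hx (hκ.y_mem _ hx))
    · exact hmono (hκ.S_sub _ hx h)
    · exact hmono (hκ.U_sub _ hx h)
  touch x hx e he := by
    rw [kitSData_K] at hx
    rw [kitSData_seed] at he
    rw [winLData_X]
    rcases κ.mem_seed_cases he with rfl | h | ⟨v, hv, u, -, -, rfl⟩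
    · exact ⟨κ.y x, Sym2.mem_mk_right _ _, hκ.S_sub _ hx (hκ.y_mem _ hx)⟩
    · induction e using Sym2.ind with
      | h a b => exact ⟨a, Sym2.mem_mk_left a b, hκ.S_sub _ hx (((mem_edgesIn_iff).1 h).2 a (Sym2.mem_mk_left a b))⟩
    · exact ⟨v, Sym2.mem_mk_left _ _, hκ.S_sub _ hx hv⟩
  card_le x hx := by
    rw [kitSData_K] at hx
    simp only [kitSData_seed, KitGeom.seed]
    calc ({s(x, κ.y x)} ∪ edgesIn G (κ.S x) ∪
            ((κ.S x ×ˢ κ.U x).filter fun q => G.Adj q.1 q.2).image fun q => s(q.1, q.2)).card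
        ≤ ({s(x, κ.y x)} ∪ edgesIn G (κ.S x)).card +
            (((κ.S x ×ˢ κ.U x).filter fun q => G.Adj q.1 q.2).image fun q => s(q.1, q.2)).card := Finset.card_union_le _ _
      _ ≤ (1 + Φ.Δ * cS) + cS * cU := by
          refine Nat.add_le_add ((Finset.card_union_le _ _).trans (Nat.add_le_add (by simp) ?_)) ?_
          · exact (card_edgesIn_le_mul G Φ.degree_le _).trans (Nat.mul_le_mul_left _ (hκ.S_card _ hx))
          · calc (((κ.S x ×ˢ κ.U x).filter fun q => G.Adj q.1 q.2).image fun q => s(q.1, q.2)).card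
                ≤ ((κ.S x ×ˢ κ.U x).filter fun q => G.Adj q.1 q.2).card := Finset.card_image_le
              _ ≤ (κ.S x ×ˢ κ.U x).card := Finset.card_filter_le _ _
              _ = (κ.S x).card * (κ.U x).card := Finset.card_product _ _
              _ ≤ cS * cU := Nat.mul_le_mul (hκ.S_card _ hx) (hκ.U_card _ hx)
      _ = 1 + Φ.Δ * cS + cS * cU := rfl
  conn x hx ω hω u hu := by
    rw [kitSData_K] at hx
    rw [kitSData_seed] at hω
    rw [kitSData_face] at hu
    -- the contact edge
    have h1 : (openGraph ω).Adj x (κ.y x) := by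
      rw [openGraph_adj]
      exact ⟨hω (Finset.mem_coe.2 (κ.contactEdge_mem_seed x)), (hκ.adj _ hx).ne⟩
    -- the open region
    have h2 : ∀ v ∈ κ.S x, (openGraph ω).Reachable (κ.y x) v := fun v hv =>
      reachable_of_pathIn_of_edgesIn (fun e he => hω (Finset.mem_coe.2 (κ.edgesIn_subset_seed x he))) (hκ.S_path _ hx v hv)
    rcases hκ.U_adj _ hx u hu with huS | ⟨v, hv, hvu⟩
    · exact h1.reachable.trans (h2 u huS)
    · -- the rung
      have h3 : (openGraph ω).Adj v u := by
        rw [openGraph_adj]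
        exact ⟨hω (Finset.mem_coe.2 (κ.rung_mem_seed hv hu hvu)), hvu.ne⟩
      exact h1.reachable.trans ((h2 v hv).trans h3.reachable)
  pick_sub c := kitSData_pick_subset Φ w₀ R lo hi j κ rs cS cU k c
  pick_card c hcK hc := (kitSData_pick_spec Φ w₀ R lo hi j κ rs cS cU k hc).1
  pick_disj c hcK hc := by
    rw [kitSData_K] at hcK
    -- every endpoint of a seed edge of `x ∈ K` lies in `B_G(x, rs)`
    have hball : ∀ x ∈ outerBoundary (winGraph G w₀ R) (winLevel Φ w₀ R lo hi j), ∀ e ∈ κ.seed G x, ∀ z ∈ e,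
        z ∈ graphBall G x rs := by
      intro x hx e he z hz
      rcases (κ.exists_mem_of_mem_seed he).2 z hz with rfl | rfl | h | h
      · exact mem_graphBall_self G _ rs
      · exact hκ.S_ball _ hx _ (hκ.y_mem _ hx)
      · exact hκ.S_ball _ hx _ h
      · exact hκ.U_ball _ hx _ h
    refine pairwiseDisjoint_apartSel (fun x => ballFin G x (2 * rs)) (center_mem_ballFin' rs) (ballFin_symm' rs)
      (pow_succ_pos' Φ.Δ rs) (fun x => card_ballFin_le G Φ.degree_le x (2 * rs)) hc fun x hx x' hx' hfar => ?_
    rw [Finset.disjoint_left]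
    intro e he he'
    induction e using Sym2.ind with
    | h a b =>
      have ha := hball x (hcK hx) _ he a (Sym2.mem_mk_left a b)
      have ha' := hball x' (hcK hx') _ he' a (Sym2.mem_mk_left a b)
      refine hfar ((mem_ballFin G).2 ?_)
      have h := BoxProdZ2.mem_graphBall_add G ha ((BoxProdZ2.mem_graphBall_comm G).1 ha')
      rwa [two_mul]

end OK

end Skel

end Transplant

end Summit.CriticalPhenomena.PercolationContinuityZ3.Theorems

end
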